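import Literature.Probability.Distributions.GaussianHypercontractivity
import Summits.QuantumFields.YangMills.Theorems.AllWindowsColdBoxBoxHighLineGaussianChartWickFintype

/-!
# T-S5.10-H «Gaussian hypercontractivity and the decorrelation of squares in the chart Gaussian `exp(−β vᵀPv) dv`»

Helper brick for planner ym-idea-2 g18's STEP 2 of the XL stub S5 `stub_landauSecondOrder` (LINE-19, cruxes
⟨stmt-QuantumFields-24004⟩/⟨24335⟩; `STUB-PLAN-S5-STEP2.md` §4 C3 and §7 R1), consumed BY NAME by the LEAD's Wick layer
(T-S5.10 «moment decorrelation»).  The plan's one sharp input of the fourth-cumulant remainder,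

  `E₀[(c̃₀^{(2)})² V₃²] ≤ C · E₀[(c̃₀^{(2)})²] · E₀[V₃²] · (1 + log H)^m`,

is, for ANY observable `F` polynomial of degree `≤ p` and `G` polynomial of degree `≤ q` in the chart variables, the case
`(p, q) = (2, 3)` of

  `E₀[F² G²] ≤ 3^{p+q} · E₀[F²] · E₀[G²]`        (`m = 0`, `C = 3⁵ = 243`; no kernel sums, no anchored pairings)

which is Cauchy–Schwarz `E₀[F²G²] ≤ ‖F‖₄² ‖G‖₄²` followed by the `(2,4)` case of GAUSSIAN HYPERCONTRACTIVITY for polynomials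
(Nelson 1973; Bonami 1970; Gross 1975; Janson 1997 Thm. 5.10), `‖F‖₄ ≤ 3^{p/2} ‖F‖₂` — a TREE THEOREM:
✓`Literature.Probability.Distributions.gaussian_bonami_mulVec` (even-moment form `E P(Az)^{2r} ≤ (2r−1)^{rd} (E P(Az)²)^r` for every
linear image `Az` of a standard Gaussian vector).  This file transports it into the letters of the LEAD's chart Gaussian
(✓`GaussianChartWick`, ✓`GaussianChartWickPosDef`, ✓`GaussianChartWickFintype`): Lebesgue integrals against `exp(−β vᵀPv)` on `ι → ℝ`,
`P : Matrix ι ι ℝ` positive definite, `β > 0`, normalisation `Z = √(π/β)^{|ι|}/√(det P)`.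

* `Hypercontractivity.integral_sq_mul_sq_le_sqrt` — Cauchy–Schwarz `∫ φ²ψ² ≤ √(∫φ⁴)√(∫ψ⁴)` (Mathlib's Hölder at `(2,2)`);
* `Hypercontractivity.measurePreserving_scale_pi_gaussianReal`, `integral_pi_gaussianReal_eq_integral_scale` — `⊗ N(0,v)` is the image of
  `⊗ N(0,1)` under `z ↦ √v·z`; `integral_mul_exp_eq_integral_std` / `integral_mul_exp_quadForm_eq_integral_std` — the chart integral
  `∫ F(v) e^{−β vᵀPv} dv = Z · ∫ F(L z) dγ(z)` with `L = √((2β)⁻¹)·M⁻¹`, `MᵀM = P` (✓`integral_mul_exp_eq_integral_pi` + scaling);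
* **`Hypercontractivity.integral_pow_mul_exp_quadForm_le` / `…_le'`** (index `Fin n` / any finite `ι`) — `Z^{r−1}·∫ Q^{2r} e ≤ (2r−1)^{rd}·(∫ Q² e)^r`
  for `deg Q ≤ d`, `r ≥ 1`;
* **`Hypercontractivity.integral_sq_mul_sq_mul_exp_quadForm_le` / `…_le'`** — `Z·∫ A²B² e ≤ 3^{p+q}·(∫ A² e)·(∫ B² e)` for `deg A ≤ p`, `deg B ≤ q`
  (compare the exact identity ✓`integral_sq_mul_sq_mul_exp_quadForm'` for two LINEAR legs: `Z·∫(a·v)²(b·v)² e = (∫(a·v)²e)(∫(b·v)²e) + Z²·2S²`);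
* the function-level forms (observables `F : (ι → ℝ) → ℝ` certified polynomial of bounded degree by an `∃`-hypothesis, closure lemmas,
  the normalised form `E₀[F²G²] ≤ 3^{p+q} E₀[F²] E₀[G²]` and a worked T-S5.10-shaped instance) are in the companion file
  `…GaussianHypercontractivityPoly.lean`.

No definitions, no named facts; Mathlib + tree only.  HONEST LABEL: an abstract probability lemma (a corollary of a Literature theorem) in
service of STEP 2 of the XL stub S5 of a critic-PASSed DRAFT line; T-S5.10 itself, S5, U5, ⟨stmt-QuantumFields-24004⟩ ⟨24335⟩ ⟨24336⟩ remain
OPEN; route AllWindowsColdBox is DRAFT; no rung is proved; **the Yang–Mills mass gap is NOT proved by this file; no summit is proved by a line.**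
Seat ym-line-sfw-p2-w5 g22 (EXTRA WIDTH seat w5, cell ym-idea-1).
-/

set_option autoImplicit false

noncomputable section

open MeasureTheory ProbabilityTheory Matrix Finset
open scoped NNReal ENNReal
open Literature.Probability.Distributions

namespace Summit.QuantumFields.YangMills.Theorems.AllWindowsColdBoxBoxHighLine

namespace Hypercontractivity

variable {ι : Type*} [Fintype ι]

/-! ## Cauchy–Schwarz for two squares (Hölder `p = q = 2` from Mathlib) -/

/-- `∫ φ² ψ² ≤ √(∫ φ⁴) · √(∫ ψ⁴)` — Cauchy–Schwarz for the nonnegative functions `φ²`, `ψ²`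
(Mathlib's `integral_mul_le_Lp_mul_Lq_of_nonneg` at the conjugate pair `(2, 2)`). -/
theorem integral_sq_mul_sq_le_sqrt {X : Type*} [MeasurableSpace X] {μ : Measure X} {φ ψ : X → ℝ}
    (hφm : AEStronglyMeasurable φ μ) (hψm : AEStronglyMeasurable ψ μ)
    (hφ : Integrable (fun x => φ x ^ 4) μ) (hψ : Integrable (fun x => ψ x ^ 4) μ) :
    ∫ x, φ x ^ 2 * ψ x ^ 2 ∂μ ≤ Real.sqrt (∫ x, φ x ^ 4 ∂μ) * Real.sqrt (∫ x, ψ x ^ 4 ∂μ) := by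
  have e2 : ENNReal.ofReal 2 = (2 : ℝ≥0∞) := by norm_num
  have e4 : ∀ x, (φ x ^ 2) ^ 2 = φ x ^ 4 := fun x => by ring
  have e4' : ∀ x, (ψ x ^ 2) ^ 2 = ψ x ^ 4 := fun x => by ring
  have hφ2m : AEStronglyMeasurable (fun x => φ x ^ 2) μ := hφm.pow 2
  have hψ2m : AEStronglyMeasurable (fun x => ψ x ^ 2) μ := hψm.pow 2
  have hf : MemLp (fun x => φ x ^ 2) (ENNReal.ofReal 2) μ := by
    rw [e2, memLp_two_iff_integrable_sq hφ2m]
    simp only [e4]; exact hφ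
  have hg : MemLp (fun x => ψ x ^ 2) (ENNReal.ofReal 2) μ := by
    rw [e2, memLp_two_iff_integrable_sq hψ2m]
    simp only [e4']; exact hψ
  have h := integral_mul_le_Lp_mul_Lq_of_nonneg Real.HolderConjugate.two_two
    (Filter.Eventually.of_forall fun x => sq_nonneg (φ x)) (Filter.Eventually.of_forall fun x => sq_nonneg (ψ x)) hf hg
  have r1 : ∀ x, (φ x ^ 2) ^ (2 : ℝ) = φ x ^ 4 := fun x => by rw [Real.rpow_two]; ring
  have r2 : ∀ x, (ψ x ^ 2) ^ (2 : ℝ) = ψ x ^ 4 := fun x => by rw [Real.rpow_two]; ring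
  simp only [r1, r2] at h
  rw [Real.sqrt_eq_rpow, Real.sqrt_eq_rpow]
  exact h

/-! ## The scaled product Gaussian `⊗ N(0, v)` is the image of the standard one under `z ↦ √v • z` -/

omit [Fintype ι] in
/-- Coordinatewise scaling by `c ≠ 0` as a measurable equivalence of `ι → ℝ`. -/
theorem coe_piCongrRight_mulLeft₀ {c : ℝ} (hc : c ≠ 0) (z : ι → ℝ) :
    (MeasurableEquiv.piCongrRight fun _ : ι => MeasurableEquiv.mulLeft₀ c hc) z = fun i => c * z i := rfl

/-- **Scaling**: `z ↦ (√v · z_i)_i` pushes `⊗ N(0,1)` to `⊗ N(0,v)`. -/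
theorem measurePreserving_scale_pi_gaussianReal (v : ℝ≥0) (hv : v ≠ 0) :
    MeasurePreserving
      (MeasurableEquiv.piCongrRight fun _ : ι =>
        MeasurableEquiv.mulLeft₀ (Real.sqrt v) (Real.sqrt_ne_zero'.mpr (by exact_mod_cast pos_iff_ne_zero.mpr hv)))
      (Measure.pi fun _ : ι => gaussianReal 0 1) (Measure.pi fun _ : ι => gaussianReal 0 v) := by
  have h1 : ∀ _i : ι, MeasurePreserving (fun t : ℝ => Real.sqrt v * t) (gaussianReal 0 1) (gaussianReal 0 v) := by
    intro i
    refine ⟨measurable_const_mul _, ?_⟩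
    rw [gaussianReal_map_const_mul]
    congr 1
    · simp
    · rw [mul_one]
      ext
      simp [Real.sq_sqrt (v.coe_nonneg)]
  exact measurePreserving_pi (fun _ : ι => gaussianReal 0 1) (fun _ : ι => gaussianReal 0 v) h1

/-- **Scaling of integrals**: `∫ F dN(0,v)^{⊗ι} = ∫ F(√v · z) dN(0,1)^{⊗ι}(z)` for every `F` (`v ≠ 0`). -/
theorem integral_pi_gaussianReal_eq_integral_scale (v : ℝ≥0) (hv : v ≠ 0) (F : (ι → ℝ) → ℝ) :
    ∫ w, F w ∂(Measure.pi fun _ : ι => gaussianReal 0 v) =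
      ∫ z, F (fun i => Real.sqrt v * z i) ∂(Measure.pi fun _ : ι => gaussianReal 0 1) := by
  rw [← (measurePreserving_scale_pi_gaussianReal v hv).integral_comp' F]
  rfl


/-! ## From the chart Gaussian `exp(−β vᵀPv) dv` to the standard Gaussian `⊗ N(0,1)` (index `Fin n`) -/

section FinCore

variable {n : ℕ}

/-- The standard deviation `√((2β)⁻¹)` of the reference product Gaussian `P_β`. -/
theorem sqrt_coe_var {β : ℝ} (hβ : 0 < β) :
    Real.sqrt ((Real.toNNReal (2 * β)⁻¹ : ℝ≥0) : ℝ) = Real.sqrt (2 * β)⁻¹ := by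
  rw [GaussianChartWick.coe_var hβ]

/-- **TRANSFER TO THE STANDARD GAUSSIAN** (every `F`): with `L = √((2β)⁻¹) • M⁻¹`,
`∫ F(v) exp(−β ‖Mv‖²) dv = √(π/β)ⁿ/|det M| · ∫ F(L z) dγₙ(z)`, `γₙ = ⊗ⁿ N(0,1)`. -/
theorem integral_mul_exp_eq_integral_std (M : Matrix (Fin n) (Fin n) ℝ) (hM : M.det ≠ 0) {β : ℝ} (hβ : 0 < β)
    (F : (Fin n → ℝ) → ℝ) :
    ∫ v, F v * Real.exp (-(β * (M *ᵥ v ⬝ᵥ M *ᵥ v))) =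
      Real.sqrt (Real.pi / β) ^ n / |M.det| *
        ∫ z, F ((Real.sqrt (2 * β)⁻¹ • M⁻¹) *ᵥ z) ∂(Measure.pi fun _ : Fin n => gaussianReal 0 1) := by
  rw [GaussianChartWick.integral_mul_exp_eq_integral_pi M hM hβ F,
    integral_pi_gaussianReal_eq_integral_scale _ (GaussianChartWick.var_ne_zero hβ) (fun w => F (M⁻¹ *ᵥ w))]
  congr 1
  refine integral_congr_ae (Filter.Eventually.of_forall fun z => ?_)
  simp only [sqrt_coe_var hβ]
  congr 1
  have hz : (fun i => Real.sqrt (2 * β)⁻¹ * z i) = Real.sqrt (2 * β)⁻¹ • z := rfl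
  rw [hz, Matrix.mulVec_smul, Matrix.smul_mulVec]

/-- Polynomials of a linear image of the standard Gaussian are integrable. -/
theorem integrable_eval_mulVec_pi (L : Matrix (Fin n) (Fin n) ℝ) (Q : MvPolynomial (Fin n) ℝ) :
    Integrable (fun z : Fin n → ℝ => MvPolynomial.eval (L *ᵥ z) Q) (Measure.pi fun _ : Fin n => gaussianReal 0 1) := by
  have h := integrable_eval_pi_gaussianReal (MvPolynomial.bind₁ (linSubst L) Q)
  simpa only [eval_bind₁_linSubst] using h

/-- **DECORRELATION UNDER THE STANDARD GAUSSIAN, linear image**: for polynomials `A`, `B` of total degree `≤ p`, `≤ q`,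
`∫ A(Lz)² B(Lz)² dγₙ ≤ 3^{p+q} · (∫ A(Lz)² dγₙ) · (∫ B(Lz)² dγₙ)` (Cauchy–Schwarz and the `(2,4)` Bonami–Nelson bound twice). -/
theorem integral_sq_mul_sq_le_std (L : Matrix (Fin n) (Fin n) ℝ) {p q : ℕ} (A B : MvPolynomial (Fin n) ℝ)
    (hA : A.totalDegree ≤ p) (hB : B.totalDegree ≤ q) :
    ∫ z, MvPolynomial.eval (L *ᵥ z) A ^ 2 * MvPolynomial.eval (L *ᵥ z) B ^ 2 ∂(Measure.pi fun _ : Fin n => gaussianReal 0 1) ≤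
      (3 : ℝ) ^ (p + q) * (∫ z, MvPolynomial.eval (L *ᵥ z) A ^ 2 ∂(Measure.pi fun _ : Fin n => gaussianReal 0 1)) *
        ∫ z, MvPolynomial.eval (L *ᵥ z) B ^ 2 ∂(Measure.pi fun _ : Fin n => gaussianReal 0 1) := by
  set γ : Measure (Fin n → ℝ) := Measure.pi fun _ : Fin n => gaussianReal 0 1 with hγ
  -- integrability of the polynomial integrands
  have iA4 : Integrable (fun z => MvPolynomial.eval (L *ᵥ z) A ^ 4) γ :=
    (integrable_eval_mulVec_pi L (A ^ 4)).congr (Filter.Eventually.of_forall fun z => map_pow _ _ _)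
  have iB4 : Integrable (fun z => MvPolynomial.eval (L *ᵥ z) B ^ 4) γ :=
    (integrable_eval_mulVec_pi L (B ^ 4)).congr (Filter.Eventually.of_forall fun z => map_pow _ _ _)
  have hCS := integral_sq_mul_sq_le_sqrt (integrable_eval_mulVec_pi L A).aestronglyMeasurable
    (integrable_eval_mulVec_pi L B).aestronglyMeasurable iA4 iB4
  -- the `(2,4)` hypercontractive bounds
  have h4A := gaussian_bonami_mulVec L p A hA 2 (by norm_num)
  have h4B := gaussian_bonami_mulVec L q B hB 2 (by norm_num)
  norm_num only [show 2 * 2 = 4 by norm_num] at h4A h4B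
  have IA0 : 0 ≤ ∫ z, MvPolynomial.eval (L *ᵥ z) A ^ 2 ∂γ := integral_nonneg fun z => sq_nonneg _
  have IB0 : 0 ≤ ∫ z, MvPolynomial.eval (L *ᵥ z) B ^ 2 ∂γ := integral_nonneg fun z => sq_nonneg _
  have hsA : Real.sqrt (∫ z, MvPolynomial.eval (L *ᵥ z) A ^ 4 ∂γ) ≤ (3 : ℝ) ^ p * ∫ z, MvPolynomial.eval (L *ᵥ z) A ^ 2 ∂γ := by
    refine Real.sqrt_le_iff.mpr ⟨by positivity, ?_⟩
    calc ∫ z, MvPolynomial.eval (L *ᵥ z) A ^ 4 ∂γ ≤ (3 : ℝ) ^ (2 * p) * (∫ z, MvPolynomial.eval (L *ᵥ z) A ^ 2 ∂γ) ^ 2 := h4A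
      _ = ((3 : ℝ) ^ p * ∫ z, MvPolynomial.eval (L *ᵥ z) A ^ 2 ∂γ) ^ 2 := by ring
  have hsB : Real.sqrt (∫ z, MvPolynomial.eval (L *ᵥ z) B ^ 4 ∂γ) ≤ (3 : ℝ) ^ q * ∫ z, MvPolynomial.eval (L *ᵥ z) B ^ 2 ∂γ := by
    refine Real.sqrt_le_iff.mpr ⟨by positivity, ?_⟩
    calc ∫ z, MvPolynomial.eval (L *ᵥ z) B ^ 4 ∂γ ≤ (3 : ℝ) ^ (2 * q) * (∫ z, MvPolynomial.eval (L *ᵥ z) B ^ 2 ∂γ) ^ 2 := h4B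
      _ = ((3 : ℝ) ^ q * ∫ z, MvPolynomial.eval (L *ᵥ z) B ^ 2 ∂γ) ^ 2 := by ring
  calc ∫ z, MvPolynomial.eval (L *ᵥ z) A ^ 2 * MvPolynomial.eval (L *ᵥ z) B ^ 2 ∂γ
      ≤ Real.sqrt (∫ z, MvPolynomial.eval (L *ᵥ z) A ^ 4 ∂γ) * Real.sqrt (∫ z, MvPolynomial.eval (L *ᵥ z) B ^ 4 ∂γ) := hCS
    _ ≤ ((3 : ℝ) ^ p * ∫ z, MvPolynomial.eval (L *ᵥ z) A ^ 2 ∂γ) * ((3 : ℝ) ^ q * ∫ z, MvPolynomial.eval (L *ᵥ z) B ^ 2 ∂γ) :=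
        mul_le_mul hsA hsB (Real.sqrt_nonneg _) (by positivity)
    _ = (3 : ℝ) ^ (p + q) * (∫ z, MvPolynomial.eval (L *ᵥ z) A ^ 2 ∂γ) * ∫ z, MvPolynomial.eval (L *ᵥ z) B ^ 2 ∂γ := by
        rw [pow_add]; ring

end FinCore


/-! ## The chart letters on `Fin n → ℝ`: `exp(−β vᵀPv) dv`, `P` positive definite -/

section FinChart

variable {n : ℕ}

/-- The chart integral of `F · exp(−β vᵀPv)` as a standard-Gaussian integral: with `MᵀM = P`, `det M ≠ 0` and
`L = √((2β)⁻¹) • M⁻¹`, `∫ F(v) exp(−β vᵀPv) dv = √(π/β)ⁿ/√(det P) · ∫ F(L z) dγₙ(z)`. -/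
theorem integral_mul_exp_quadForm_eq_integral_std {P M : Matrix (Fin n) (Fin n) ℝ} (hMP : Mᵀ * M = P) (hM : M.det ≠ 0)
    {β : ℝ} (hβ : 0 < β) (F : (Fin n → ℝ) → ℝ) :
    ∫ v, F v * Real.exp (-(β * (v ⬝ᵥ P *ᵥ v))) =
      Real.sqrt (Real.pi / β) ^ n / Real.sqrt P.det *
        ∫ z, F ((Real.sqrt (2 * β)⁻¹ • M⁻¹) *ᵥ z) ∂(Measure.pi fun _ : Fin n => gaussianReal 0 1) := by
  have h := integral_mul_exp_eq_integral_std M hM hβ F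
  simp only [GaussianChartWick.mulVec_dotProduct_mulVec_of_transpose_mul_self hMP] at h
  rw [h, GaussianChartWick.abs_det_eq_sqrt_det_of_transpose_mul_self hMP]

/-- **GAUSSIAN HYPERCONTRACTIVITY IN THE CHART** (Bonami–Nelson–Gross, even-moment form): for a positive-definite precision `P`,
`β > 0`, a polynomial `Q` of total degree `≤ d` and `r ≥ 1`, with `Z = ∫ exp(−β vᵀPv) dv = √(π/β)ⁿ/√(det P)`:
`Z^{r−1} · ∫ Q(v)^{2r} e^{−β vᵀPv} dv ≤ (2r−1)^{rd} · (∫ Q(v)² e^{−β vᵀPv} dv)^r`, i.e. `E₀[Q^{2r}] ≤ (2r−1)^{rd} E₀[Q²]^r`. -/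
theorem integral_pow_mul_exp_quadForm_le (P : Matrix (Fin n) (Fin n) ℝ) (hP : P.PosDef) {β : ℝ} (hβ : 0 < β)
    (d : ℕ) (Q : MvPolynomial (Fin n) ℝ) (hQ : Q.totalDegree ≤ d) (r : ℕ) (hr : 1 ≤ r) :
    (Real.sqrt (Real.pi / β) ^ n / Real.sqrt P.det) ^ (r - 1) *
        ∫ v, MvPolynomial.eval v Q ^ (2 * r) * Real.exp (-(β * (v ⬝ᵥ P *ᵥ v))) ≤
      (2 * r - 1 : ℝ) ^ (r * d) * (∫ v, MvPolynomial.eval v Q ^ 2 * Real.exp (-(β * (v ⬝ᵥ P *ᵥ v)))) ^ r := by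
  obtain ⟨M, hMP, hM⟩ := GaussianChartWick.exists_transpose_mul_self_of_posDef P hP
  set L : Matrix (Fin n) (Fin n) ℝ := Real.sqrt (2 * β)⁻¹ • M⁻¹ with hL
  set Z : ℝ := Real.sqrt (Real.pi / β) ^ n / Real.sqrt P.det with hZ
  have hZ0 : 0 ≤ Z := by positivity
  rw [integral_mul_exp_quadForm_eq_integral_std hMP hM hβ (fun v => MvPolynomial.eval v Q ^ (2 * r)),
    integral_mul_exp_quadForm_eq_integral_std hMP hM hβ (fun v => MvPolynomial.eval v Q ^ 2)]
  have hB := gaussian_bonami_mulVec L d Q hQ r hr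
  have hr' : r - 1 + 1 = r := Nat.sub_add_cancel hr
  calc Z ^ (r - 1) * (Z * ∫ z, MvPolynomial.eval (L *ᵥ z) Q ^ (2 * r) ∂(Measure.pi fun _ : Fin n => gaussianReal 0 1))
      = Z ^ r * ∫ z, MvPolynomial.eval (L *ᵥ z) Q ^ (2 * r) ∂(Measure.pi fun _ : Fin n => gaussianReal 0 1) := by
        rw [← mul_assoc, ← pow_succ, hr']
    _ ≤ Z ^ r * ((2 * r - 1 : ℝ) ^ (r * d) *
          (∫ z, MvPolynomial.eval (L *ᵥ z) Q ^ 2 ∂(Measure.pi fun _ : Fin n => gaussianReal 0 1)) ^ r) :=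
        mul_le_mul_of_nonneg_left hB (pow_nonneg hZ0 _)
    _ = (2 * r - 1 : ℝ) ^ (r * d) * (Z * ∫ z, MvPolynomial.eval (L *ᵥ z) Q ^ 2 ∂(Measure.pi fun _ : Fin n => gaussianReal 0 1)) ^ r := by
        rw [mul_pow]; ring

/-- **DECORRELATION OF SQUARES IN THE CHART** (the T-S5.10 engine): for a positive-definite precision `P`, `β > 0` and polynomials
`A`, `B` of total degree `≤ p`, `≤ q`, with `Z = √(π/β)ⁿ/√(det P) = ∫ exp(−β vᵀPv) dv`:
`Z · ∫ A(v)² B(v)² e^{−β vᵀPv} dv ≤ 3^{p+q} · (∫ A(v)² e^{−β vᵀPv} dv) · (∫ B(v)² e^{−β vᵀPv} dv)`,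
i.e. `E₀[A²B²] ≤ 3^{p+q} · E₀[A²] · E₀[B²]` — no kernel input, no logarithm. -/
theorem integral_sq_mul_sq_mul_exp_quadForm_le (P : Matrix (Fin n) (Fin n) ℝ) (hP : P.PosDef) {β : ℝ} (hβ : 0 < β)
    {p q : ℕ} (A B : MvPolynomial (Fin n) ℝ) (hA : A.totalDegree ≤ p) (hB : B.totalDegree ≤ q) :
    Real.sqrt (Real.pi / β) ^ n / Real.sqrt P.det *
        ∫ v, MvPolynomial.eval v A ^ 2 * MvPolynomial.eval v B ^ 2 * Real.exp (-(β * (v ⬝ᵥ P *ᵥ v))) ≤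
      (3 : ℝ) ^ (p + q) * (∫ v, MvPolynomial.eval v A ^ 2 * Real.exp (-(β * (v ⬝ᵥ P *ᵥ v)))) *
        ∫ v, MvPolynomial.eval v B ^ 2 * Real.exp (-(β * (v ⬝ᵥ P *ᵥ v))) := by
  obtain ⟨M, hMP, hM⟩ := GaussianChartWick.exists_transpose_mul_self_of_posDef P hP
  set L : Matrix (Fin n) (Fin n) ℝ := Real.sqrt (2 * β)⁻¹ • M⁻¹ with hL
  set Z : ℝ := Real.sqrt (Real.pi / β) ^ n / Real.sqrt P.det with hZ
  have hZ0 : 0 ≤ Z := by positivity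
  rw [integral_mul_exp_quadForm_eq_integral_std hMP hM hβ (fun v => MvPolynomial.eval v A ^ 2 * MvPolynomial.eval v B ^ 2),
    integral_mul_exp_quadForm_eq_integral_std hMP hM hβ (fun v => MvPolynomial.eval v A ^ 2),
    integral_mul_exp_quadForm_eq_integral_std hMP hM hβ (fun v => MvPolynomial.eval v B ^ 2)]
  have h := integral_sq_mul_sq_le_std L A B hA hB
  calc Z * (Z * ∫ z, MvPolynomial.eval (L *ᵥ z) A ^ 2 * MvPolynomial.eval (L *ᵥ z) B ^ 2 ∂(Measure.pi fun _ : Fin n => gaussianReal 0 1))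
      ≤ Z * (Z * ((3 : ℝ) ^ (p + q) * (∫ z, MvPolynomial.eval (L *ᵥ z) A ^ 2 ∂(Measure.pi fun _ : Fin n => gaussianReal 0 1)) *
          ∫ z, MvPolynomial.eval (L *ᵥ z) B ^ 2 ∂(Measure.pi fun _ : Fin n => gaussianReal 0 1))) :=
        mul_le_mul_of_nonneg_left (mul_le_mul_of_nonneg_left h hZ0) hZ0
    _ = (3 : ℝ) ^ (p + q) * (Z * ∫ z, MvPolynomial.eval (L *ᵥ z) A ^ 2 ∂(Measure.pi fun _ : Fin n => gaussianReal 0 1)) *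
          (Z * ∫ z, MvPolynomial.eval (L *ᵥ z) B ^ 2 ∂(Measure.pi fun _ : Fin n => gaussianReal 0 1)) := by ring

end FinChart


/-! ## The chart letters over an arbitrary finite index type `ι` (transport along `Fintype.equivFin ι`) -/

section FintypeChart

variable [DecidableEq ι]

omit [DecidableEq ι] in
/-- Evaluating at reindexed coordinates is evaluating the renamed polynomial. -/
theorem eval_comp_equivFin (A : MvPolynomial ι ℝ) (w : Fin (Fintype.card ι) → ℝ) :
    MvPolynomial.eval (fun i => w (Fintype.equivFin ι i)) A =
      MvPolynomial.eval w (MvPolynomial.rename (Fintype.equivFin ι) A) := by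
  rw [MvPolynomial.eval_rename]; rfl

omit [DecidableEq ι] in
/-- Transport of a chart integral of two polynomial observables along `Fintype.equivFin ι`. -/
theorem integral_poly₂_mul_exp_quadForm_comp_equivFin (P : Matrix ι ι ℝ) (β : ℝ) (A B : MvPolynomial ι ℝ)
    (Φ : ℝ → ℝ → ℝ) :
    ∫ v : ι → ℝ, Φ (MvPolynomial.eval v A) (MvPolynomial.eval v B) * Real.exp (-(β * (v ⬝ᵥ P *ᵥ v))) =
      ∫ w : Fin (Fintype.card ι) → ℝ,
        Φ (MvPolynomial.eval w (MvPolynomial.rename (Fintype.equivFin ι) A))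
          (MvPolynomial.eval w (MvPolynomial.rename (Fintype.equivFin ι) B)) *
          Real.exp (-(β * (w ⬝ᵥ P.submatrix (Fintype.equivFin ι).symm (Fintype.equivFin ι).symm *ᵥ w))) := by
  rw [← GaussianChartWick.integral_comp_equivFin]
  refine integral_congr_ae (Filter.Eventually.of_forall fun w => ?_)
  simp only [eval_comp_equivFin, quadForm_comp_equivFin]

/-- **GAUSSIAN HYPERCONTRACTIVITY IN THE CHART over `ι → ℝ`**: `Z^{r−1} · ∫ Q^{2r} e^{−β vᵀPv} ≤ (2r−1)^{rd} · (∫ Q² e^{−β vᵀPv})^r`,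
`Z = √(π/β)^{|ι|}/√(det P)`, for `P` positive definite, `β > 0`, `deg Q ≤ d`, `r ≥ 1`. -/
theorem integral_pow_mul_exp_quadForm_le' (P : Matrix ι ι ℝ) (hP : P.PosDef) {β : ℝ} (hβ : 0 < β)
    (d : ℕ) (Q : MvPolynomial ι ℝ) (hQ : Q.totalDegree ≤ d) (r : ℕ) (hr : 1 ≤ r) :
    (Real.sqrt (Real.pi / β) ^ Fintype.card ι / Real.sqrt P.det) ^ (r - 1) *
        ∫ v : ι → ℝ, MvPolynomial.eval v Q ^ (2 * r) * Real.exp (-(β * (v ⬝ᵥ P *ᵥ v))) ≤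
      (2 * r - 1 : ℝ) ^ (r * d) * (∫ v : ι → ℝ, MvPolynomial.eval v Q ^ 2 * Real.exp (-(β * (v ⬝ᵥ P *ᵥ v)))) ^ r := by
  have h1 := integral_poly₂_mul_exp_quadForm_comp_equivFin P β Q Q (fun a _ => a ^ (2 * r))
  have h2 := integral_poly₂_mul_exp_quadForm_comp_equivFin P β Q Q (fun a _ => a ^ 2)
  rw [h1, h2, ← det_submatrix_equivFin P]
  exact integral_pow_mul_exp_quadForm_le _ (posDef_submatrix_equivFin P hP) hβ d _
    ((MvPolynomial.totalDegree_rename_le _ _).trans hQ) r hr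

/-- **DECORRELATION OF SQUARES IN THE CHART over `ι → ℝ`** (the T-S5.10 engine in the letters of ✓`GaussianChartWickFintype`):
for `P : Matrix ι ι ℝ` positive definite, `β > 0`, polynomials `A`, `B` of total degree `≤ p`, `≤ q`, and
`Z = √(π/β)^{|ι|}/√(det P) = ∫ exp(−β vᵀPv) dv`:
`Z · ∫ A² B² e^{−β vᵀPv} dv ≤ 3^{p+q} · (∫ A² e^{−β vᵀPv} dv) · (∫ B² e^{−β vᵀPv} dv)`. -/
theorem integral_sq_mul_sq_mul_exp_quadForm_le' (P : Matrix ι ι ℝ) (hP : P.PosDef) {β : ℝ} (hβ : 0 < β)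
    {p q : ℕ} (A B : MvPolynomial ι ℝ) (hA : A.totalDegree ≤ p) (hB : B.totalDegree ≤ q) :
    Real.sqrt (Real.pi / β) ^ Fintype.card ι / Real.sqrt P.det *
        ∫ v : ι → ℝ, MvPolynomial.eval v A ^ 2 * MvPolynomial.eval v B ^ 2 * Real.exp (-(β * (v ⬝ᵥ P *ᵥ v))) ≤
      (3 : ℝ) ^ (p + q) * (∫ v : ι → ℝ, MvPolynomial.eval v A ^ 2 * Real.exp (-(β * (v ⬝ᵥ P *ᵥ v)))) *
        ∫ v : ι → ℝ, MvPolynomial.eval v B ^ 2 * Real.exp (-(β * (v ⬝ᵥ P *ᵥ v))) := by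
  have h1 := integral_poly₂_mul_exp_quadForm_comp_equivFin P β A B (fun a b => a ^ 2 * b ^ 2)
  have h2 := integral_poly₂_mul_exp_quadForm_comp_equivFin P β A B (fun a _ => a ^ 2)
  have h3 := integral_poly₂_mul_exp_quadForm_comp_equivFin P β A B (fun _ b => b ^ 2)
  rw [h1, h2, h3, ← det_submatrix_equivFin P]
  exact integral_sq_mul_sq_mul_exp_quadForm_le _ (posDef_submatrix_equivFin P hP) hβ _ _
    ((MvPolynomial.totalDegree_rename_le _ _).trans hA) ((MvPolynomial.totalDegree_rename_le _ _).trans hB)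

end FintypeChart

end Hypercontractivity

end Summit.QuantumFields.YangMills.Theorems.AllWindowsColdBoxBoxHighLine

end
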